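import Summits.HodgeConjecture.HodgeCM.PerL34.S5QautSeesaw_1

/-! PORT of `HodgeCM/PerL34/S5QautSeesaw.lean` (HodgeCMPerL run 82) — part 2: continuation of `Summits.HodgeConjecture.HodgeCM.PerL34.S5QautSeesaw_1` (split at a top-level declaration boundary by port_pkg.py; scope re-opened below; declarations unchanged). -/

-- port_pkg: scope re-opened for this part (file-level context, then the namespace/section stack open at the cut)
set_option autoImplicit false
noncomputable section
open MeasureTheory Matrix
open HodgeCM.Prior.Perl34File
open HodgeCM.PerL34.Qaut (pr prL prL_apply wedge)
open HodgeCM.PerL34.P43KTypesU2 (Jplus diagK jplusSubmodule)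
open HodgeCM.PerL34.QautFock (pPlusMat continuous_pPlusMat isUnit_det_pPlusMat formOf QautFockBridge
  N19g_core_of_fockBridge nonempty_qautBridge_of_fockBridge N19_genIn_of_fockBridge open_thetaReal34_of_fockBridges)
open HodgeCM.PerL34.Seesaw
namespace HodgeCM
namespace PerL34
namespace QautSeesaw
variable {U : Universe} (T : U.ThetaModel)
variable {L : CMField} {ι₁ : L →+* ℂ} (V : HermSpace3 L ι₁) (c : SeesawCtx L)
variable (D : Perl34.TorusData (T.core V c)) (k l : Fin 4)
namespace QautSeesawBridge
variable {T V c D k l}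
variable (R : QautSeesawBridge T V c D k l)
/-- **(ii) `K`-type transport, DERIVED** (l. 362–363): the theta map `p ↦ θ(p ⊗ a, χ'₁)` is `K_∞`-equivariant for
the Fock action at `ι₁` — `R(x) θ(p ⊗ a, χ') = θ(ω(x)(p ⊗ a), χ') = θ((Jplus (κ x) p) ⊗ a, χ')`. -/
theorem sigma_thetaJ₁ (χ : D.X) {a : R.Away₁} (ha : R.Adm₁ χ a) (x : R.K) (p : jplusSubmodule) :
    R.σ x (R.thetaJ₁ χ a p) = R.thetaJ₁ χ a (Jplus (R.κ x) p) := by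
  apply R.evalC_injective
  funext g
  rw [R.evalC_sigma, R.evalC_thetaJ₁, R.evalC_thetaJ₁, ← R.emb_equiv₁ χ a ha x p, R.thetaLift₁_ωK]

/-- (Ported verbatim from the HodgeCMPerL package; no docstring in the source.) -/
theorem sigma_thetaJ₂ (χ : D.X) {a : R.Away₂} (ha : R.Adm₂ χ a) (x : R.K) (p : jplusSubmodule) :
    R.σ x (R.thetaJ₂ χ a p) = R.thetaJ₂ χ a (Jplus (R.κ x) p) := by
  apply R.evalC_injective
  funext g
  rw [R.evalC_sigma, R.evalC_thetaJ₂, R.evalC_thetaJ₂, ← R.emb_equiv₂ χ a ha x p, R.thetaLift₂_ωK]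

/-- (Ported verbatim from the HodgeCMPerL package; no docstring in the source.) -/
theorem equiv₁ (χ : D.X) :
    ∀ ψ ∈ R.Ψ₁ χ, ∀ (x : R.K) (p : jplusSubmodule), R.σ x (ψ p) = ψ (Jplus (R.κ x) p) := by
  rintro _ ⟨a, ha, rfl⟩ x p
  exact R.sigma_thetaJ₁ χ ha x p

/-- (Ported verbatim from the HodgeCMPerL package; no docstring in the source.) -/
theorem equiv₂ (χ : D.X) :
    ∀ ψ ∈ R.Ψ₂ χ, ∀ (x : R.K) (p : jplusSubmodule), R.σ x (ψ p) = ψ (Jplus (R.κ x) p) := by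
  rintro _ ⟨a, ha, rfl⟩ x p
  exact R.sigma_thetaJ₂ χ ha x p

/-- **(i) (eq:seesaw) on a finite sum of pure tensors, DERIVED in `C`** (l. 360–362, node N17 for the side):
`ϑ_{T',χ}(Σ_i (p₁ⁱ⊗a₁ⁱ) ⊗ (p₂ⁱ⊗a₂ⁱ)) = Σ_i θ(p₁ⁱ⊗a₁ⁱ, χ'₁) · θ(p₂ⁱ⊗a₂ⁱ, χ'₂)` as elements of `C` — pv11's
`eq_seesaw` termwise, additivity of `ϑ_{T',χ}` (§2), and injectivity / multiplicativity of `evalC`. -/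
theorem periodC_sum_tmul (χ : D.X) {n : ℕ} (a₁ : Fin n → R.Away₁) (a₂ : Fin n → R.Away₂)
    (p₁ p₂ : Fin n → jplusSubmodule) (hadm : ∀ i, R.Adm₁ χ (a₁ i) ∧ R.Adm₂ χ (a₂ i)) :
    R.periodC χ (∑ i, R.DS.tmul (R.emb₁ (a₁ i) (p₁ i)) (R.emb₂ (a₂ i) (p₂ i))) =
      ∑ i, R.thetaJ₁ χ (a₁ i) (p₁ i) * R.thetaJ₂ χ (a₂ i) (p₂ i) := by
  apply R.evalC_injective
  funext g
  rw [R.evalC_periodC, map_sum, Finset.sum_apply,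
    thetaPeriod_sum_tmul R.DS R.ν₁ R.ν₂ R.omegaSub R.evSub R.evalTmul R.restrictTmul R.absSummable₁
      R.absSummable₂ (R.ch₁ χ) (R.ch₂ χ) Finset.univ (fun i => R.emb₁ (a₁ i) (p₁ i))
      (fun i => R.emb₂ (a₂ i) (p₂ i)) (fun i _ g' => R.integrable₁ χ (a₁ i) (hadm i).1 (p₁ i) g')
      (fun i _ g' => R.integrable₂ χ (a₂ i) (hadm i).2 (p₂ i) g') g]
  refine Finset.sum_congr rfl fun i _ => ?_
  rw [map_mul, Pi.mul_apply, R.evalC_thetaJ₁, R.evalC_thetaJ₂]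

/-- `𝔭₊` of the shell (as in `QautFockBridge.ρ`): `pPlusMat ∘ κ`. -/
theorem ρ_cont : Continuous fun x => (pPlusMat.comp R.κ) x := continuous_pPlusMat.comp R.κ_cont

/-- (Ported verbatim from the HodgeCMPerL package; no docstring in the source.) -/
theorem ρ_det (x : R.K) : IsUnit ((pPlusMat.comp R.κ) x).det := isUnit_det_pPlusMat (R.κ x)

/-- **(i) in the form of pv08-g4's field `seesawPure`, DERIVED:** for `Φ ∈ P`,
`D.ϑ χ Φ = [Σ_i pr_κ(θ(p₁ⁱ⊗a₁ⁱ,χ'₁) θ(p₂ⁱ⊗a₂ⁱ,χ'₂))]`. -/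
theorem seesawPure (χ : D.X) (hχ : D.allowed χ) (Φ : T.SK V c) (hΦ : Φ ∈ R.P) :
    ∃ (n : ℕ) (ψ₁ ψ₂ : Fin n → (jplusSubmodule →ₗ[ℂ] R.C)) (p₁ p₂ : Fin n → jplusSubmodule),
      (∀ i, ψ₁ i ∈ R.Ψ₁ χ ∧ ψ₂ i ∈ R.Ψ₂ χ) ∧
        D.ϑ χ Φ = R.toHG (∑ i, pr R.μ (pPlusMat.comp R.κ) R.σ (ψ₁ i (p₁ i) * ψ₂ i (p₂ i))) := by
  obtain ⟨n, a₁, a₂, p₁, p₂, hadm, hϑ⟩ := R.ϑ_pr χ hχ Φ hΦ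
  refine ⟨n, fun i => R.thetaJ₁ χ (a₁ i), fun i => R.thetaJ₂ χ (a₂ i), p₁, p₂,
    fun i => ⟨⟨a₁ i, (hadm i).1, rfl⟩, ⟨a₂ i, (hadm i).2, rfl⟩⟩, ?_⟩
  rw [hϑ, R.periodC_sum_tmul χ a₁ a₂ p₁ p₂ hadm, ← prL_apply R.ρ_cont R.ρ_det R.σ_cont, map_sum]
  simp only [prL_apply]

/-- **The constructor: pv08-g4's record from the lattice-shell record** — archimedean fields copied, `Ψ_j` DEFINED,
`equiv_j` and `seesawPure` DERIVED. -/
def toFockBridge : QautFockBridge T V c D k l where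
  K := R.K
  μ := R.μ
  C := R.C
  σ := R.σ
  σ_cont := R.σ_cont
  κ := R.κ
  κ_cont := R.κ_cont
  ρ_diag := R.ρ_diag
  ρ_antidiag := R.ρ_antidiag
  k₀ := R.k₀
  d₀ := R.d₀
  κ_k₀ := R.κ_k₀
  d₀_pow_ne_one := R.d₀_pow_ne_one
  toHG := R.toHG
  Ψ₁ := R.Ψ₁
  Ψ₂ := R.Ψ₂
  equiv₁ := R.equiv₁
  equiv₂ := R.equiv₂
  wedge_mem := by
    rintro χ hχ _ ⟨a₁, ha₁, rfl⟩ _ ⟨a₂, ha₂, rfl⟩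
    exact R.wedge_mem χ hχ a₁ ha₁ a₂ ha₂
  P := R.P
  dense := R.dense
  seesawPure := R.seesawPure

end QautSeesawBridge

variable {T V c D k l}

/-- **Seam S5, `N19g` half, from the lattice-shell record (KERNEL modulo its labelled fields):** (eq:seesaw) on pure
tensors, the `K`-type transport, the `K_{ι₁}`-type list of `J⁺`, the `U(1)`-weight count and the wedge combination
of PerL ll. 360–372 are all discharged in the kernel (pv11's shell + pv12/pv14's Fock model + pv02's shell). -/
theorem N19g_core_of_seesawBridge (R : QautSeesawBridge T V c D k l) : N19g_core T V c D k l :=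
  N19g_core_of_fockBridge R.toFockBridge

/-- pv08-g4's record follows. -/
theorem nonempty_fockBridge_of_seesawBridge (R : QautSeesawBridge T V c D k l) :
    Nonempty (QautFockBridge T V c D k l) :=
  ⟨R.toFockBridge⟩

/-- … and the landed run-22 record (pv02-g2 `QautDictionary.QautBridge`). -/
theorem nonempty_qautBridge_of_seesawBridge (R : QautSeesawBridge T V c D k l) :
    Nonempty (QautDictionary.QautBridge T V c D k l) :=
  nonempty_qautBridge_of_fockBridge R.toFockBridge

/-- Lemma 3.5 (gen ⊆ closed wedge span) for the side, from the lattice-shell record. -/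
theorem N19_genIn_of_seesawBridge (R : QautSeesawBridge T V c D k l) : N19_genIn T V c D k l :=
  N19_genIn_of_fockBridge R.toFockBridge

variable (T) in
/-- **pv08's adapter with its hypothesis DISCHARGED from the lattice-shell records:** a record at every good context
for the (34) side gives the realisation input `Open_thetaReal34` (the `h19g` of `perL_of_nodes`, the field
`thetaReal34` of `ThetaModel.Inputs`). -/
theorem open_thetaReal34_of_seesawBridges
    (hR : ∀ {L : CMField} {ι₁ : L →+* ℂ} (V : HermSpace3 L ι₁) (c : SeesawCtx L), T.GoodCtx ι₁ c →
      Nonempty (QautSeesawBridge T V c (T.t34 V c) 2 3)) :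
    T.Open_thetaReal34 :=
  open_thetaReal34_of_fockBridges T fun V c hc => (hR V c hc).elim fun R => ⟨R.toFockBridge⟩

end QautSeesaw
end PerL34
end HodgeCM

end
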